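import Literature.NumberTheory.EllipticCurves.KellerYin2024.HeegnerPointMainConjecture
import Literature.NumberTheory.EllipticCurves.Castella2024.LambdaAdicHeegnerClass
import Literature.NumberTheory.EllipticCurves.PAdicHeights
import HarnessLib

/-!
# Keller–Yin (arXiv:2402.12781v2), Theorem 5.2.1 (`multHg`): the Heegner point main conjecture at an
# Eisenstein prime `p ‖ N` of MULTIPLICATIVE reduction, with Castella's class `𝐳_∞^*` (the `Λ`-adic
# Heegner class `𝐳_∞` at non-split `p`, its derivative `𝐳_∞'`, `𝐳_∞ = (γ-1)𝐳_∞'`, at split `p`) —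
# the elliptic-curve case, as an explicitly labelled OPEN hypothesis (UNREFEREED PREPRINT)

HONEST FRAMING (cell `bsd-littype`, seat `bsd-littype-05`, re-seat g2; cross-ladder
LITERATURE-TYPING layer D-0088(4): typed ≠ proved ≠ endorsed). T. Keller, M. Yin, arXiv:2402.12781v2
is an UNREFEREED PREPRINT, and the printed proof of its Thm. 5.2.1 rests on F. Castella,
arXiv:2409.01360 (Thm. 2.2, Cor. 2.3, Prop. 3.2), ALSO UNREFEREED. Nothing in this file is a theorem
about elliptic curves: the one `def … : Prop` below TRANSCRIBES Thm. 5.2.1 for an elliptic curve over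
`ℚ` (`f ↔ E`, `ℤ[f] = ℤ`) with the suffix `_OPEN` and the tag `[claim: KellerYin2024, status:
under-review]` (D-0012), to be taken as an explicit hypothesis; everything else is PROVED bookkeeping.
This is the item recorded as a typed GAP by the first seat (`FAITHFULNESS-05.md` §3, "Thm 5.2.1
multHg: no Literature object for the Λ-adic Heegner class at p ‖ N") and now statable through the
definition `Castella2024.IsLambdaAdicHeegnerClass` (`Castella2024/LambdaAdicHeegnerClass.lean`).
Companions: Theorem D = Thm. 5.1.3 (the BDP-side "imc mult" to which Thm. 5.2.1 is printed to be
equivalent) and Theorem E ⊇ Cor. 5.2.2 (the `p`-converse deduced from Thm. 5.2.1) in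
`MultiplicativeReduction.lean`; Theorem B (the same Heegner point main conjecture at a GOOD Eisenstein
prime) in `HeegnerPointMainConjecture.lean`, whose layout (`LambdaAdicSelmerData` / `HeegnerFamily` /
`SelmerDualData`, hypothesis bundle as a `structure … : Prop`) is reused here field by field.

## The source, verbatim (v2 TeX of record `run/shared/lean/pub/bsd-eis/lit/src/ky24-v2/main.tex`;
## PDF pages from `…/PAGEMAP-v2.md`; Thm. 5.2.1 is ABSENT from arXiv v1)

* §5 standing (L1717–L1718, PDF p. 43): "Let `f ∈ S_2(Γ_0(N))` be a newform of weight `2` … a chosen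
  prime above `p ≠ 2` … assume `ρ̄_f` is reducible … Further assume that `p ∣∣ N`, so `f` has bad
  multiplicative reduction at `p`." `K` as in §0.1 (L230): "a Heegner field for `N`, i.e., an
  imaginary quadratic field such that all primes dividing `N` split completely in `K` … `D_K` is odd
  and `≠ -3`, and … `p = v v̄` splits in `K`."
* §5.2 (L1778–L1781, PDF p. 44): "As in [Cas24], one can consider a Heegner class
  `𝐳_∞^* ∈ H¹_{𝓕_Λ}(K, 𝐓)` which is either a standard `Λ`-adic Heegner class `𝐳_∞` (denoted as `κ_∞`
  by us in section 3) in the non-split multiplicative case, or a derived Heegner class `𝐳_∞'` defined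
  by the relation `𝐳_∞ = (γ-1)𝐳_∞'` in the split multiplicative case. Here `γ` is a topological
  generator of `Gal(K_∞/K)`, and this `(γ-1)` factor reflects a trivial zero of the `p`-adic
  `L`-function. We have the following Heegner Point Main Conjecture for multiplicative primes (the
  definitions are the same as those for good ordinary primes)."
* **Theorem 5.2.1** (label `multHg`, L1783–L1787, PDF pp. 44–45): "Let `f ∈ S_2(Γ_0(N))` be a
  newform of weight `2` and assume that `p ∣∣ N` is an Eisenstein prime for `f`. Then both
  `H¹_{𝓕_Λ}(K, 𝐓)` and `𝒳 = H¹_{𝓕_Λ}(K, M_f)^∨` have `Λ`-rank one, and the equality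
  `Char_Λ(𝒳_tors) = Char_Λ(H¹_{𝓕_Λ}(K, 𝐓)/Λ𝐳_∞^*)²` holds." Printed proof (L1788–L1792): "This
  follows from the explicit reciprocity law [Cas24, Theorem 2.2, Corollary 2.3] for both split and
  non-split cases, which can be applied to prove the equivalence of this Heegner Point Main
  Conjecture to Thm. 5.1.3 [`imc mult`]. In showing the equivalence using [Cas24, Proposition 3.2]
  (also [BCK21, Theorem 5.1]), we could again first assume `H⁰(K, ρ̄_f) = 0` … and deduce the general
  case using a combination of Ribet's lemma and the invariance of the Main Conjectures."
* Castella 2024 §1 / §2.2 (`[corpus: paper:arxiv-2409.01360 p0003:L40–L80, p0005:L19–L60]`): `𝔖_p :=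
  lim←_L lim←_r Sel_{p^r}(E/L)` (`L ⊂ K_∞`), `X := Hom_cts(Sel_{p^∞}(E/K_∞), ℚ_p/ℤ_p)`, `𝐳_∞^*`
  "the `Λ`-adic Heegner class `𝐳_∞` or its derivative `𝐳_∞'` according to whether `E` has nonsplit
  or split multiplicative reduction at `p`"; `α = a_p = 1` or `-1` (split / nonsplit); "When
  `E(K)[p] = 0` (so the `Λ`-module `𝔖_p` is torsion-free), `𝐳_∞'` is uniquely determined by (2.3)."

## Transcription (tree vocabulary only; nothing re-declared)

* `Thm521Hypotheses N W K p κ γ` := `E/ℚ` elliptic of conductor `N` (the level of the Heegner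
  family); "`p ≠ 2`", "`p ∣∣ N` … multiplicative" — `2 < p`, `Mult W p` (for `N = N_E` this IS
  `p ∣∣ N`, `f_p = 1`); "Eisenstein" — `Red W p` (residual reducibility, the paper's standing meaning,
  §0.1 L228); `K` imaginary quadratic with (Heeg) for `N`, (disc) `D_K` odd and `≠ -3`, (spl) `p`
  split (printed in §0.1; automatic here since `p ∣ N`, `Thm521Hypotheses.split_of_dvd`); `κ` the
  anticyclotomic `ℤ_p`-extension with topological generator `γ`; AND the EXTRA standing hypothesis
  `p ∤ h_K` of the tree's Heegner-family vocabulary (`K_n ⊆ K[p^{n+1}]`, under which `F.z n` are the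
  genuine norms and `Castella2024.IsLambdaAdicHeegnerClass` is Castella's `𝐳_∞`; flag `KY521-hK`,
  exactly as `KYB-hK` of Theorem B and the sibling CGS Theorem C; KY do not print it — special case,
  `-- TODO(general form)`).
* `H¹_{𝓕_Λ}(K, 𝐓)` = Castella's `𝔖_p` = a `Λ`-adic Selmer datum `D` (`D.S`); `𝒳` = `X` = a
  Selmer-dual datum `X` (`X.X`) — "the definitions are the same as those for good ordinary primes",
  i.e. the dictionary of Theorem B / CGS Theorem C (flag `KY521-Sel`: at `p ‖ N` KY's
  `𝓕_Λ`-objects — strict/ordinary local condition at `w ∣ p`, [CGLS] §3 — are read as Castella's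
  classical compact/discrete Selmer limits `𝔖_p`, `X`, the objects of the [Cas24, Prop. 3.2 (ii)]
  equivalence the printed proof invokes; [Cas24] §3 (TeX l.720–747): `Sel_{p^∞}(E/K_∞) → Sel_str` is
  a `Λ`-pseudo-isomorphism [coates-greenberg], and rank and `char_Λ(·_tors)` are pseudo-isomorphism
  invariants — whereas Greenberg's larger `𝔖_Gr` is the object of [Cas24] Conj. 3.3 with the
  UNDERIVED class `𝐳_∞`, which is NOT what Thm. 5.2.1 prints).
* `Λ𝐳_∞^*`: for a Heegner family `F` at level `N` and a class `z ∈ D.S` with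
  `IsLambdaAdicHeegnerClass D F α z`, `α = -1` at NON-SPLIT `p` (`¬ HasSplitMultiplicativeReductionAtPrime`):
  `𝐳_∞^* = z`, conclusion `char_Λ(𝒳_tors) = char_Λ(𝔖/Λz)²`; `α = 1` at SPLIT `p`: `𝐳_∞^* = 𝐳_∞'`
  with `z = (γ-1) • 𝐳_∞'`, i.e. `z = T • z'` (`LambdaAdicSelmerData.proj_X`), conclusion
  `∃ z', z = T • z' ∧ char_Λ(𝒳_tors) = char_Λ(𝔖/Λz')²` — EXISTENTIAL in `z'` (Castella's `𝐳_∞'` is a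
  specific class satisfying (2.3), unique only when `𝔖_p` is torsion-free; quantifying `∀ z'` would be
  STRONGER than print when `E(K)[p] ≠ 0`; flag `KY521-deriv`). Both readings are quantified `∀ z`
  with the defining property (there is at most one, `IsLambdaAdicHeegnerClass.unique`; its existence
  = BD96 Prop. 2.7 / [Cas24] §2.2 is not asserted) — WEAKER-or-equal to print.
* "both have `Λ`-rank one" — `Module.Finite Λ _ ∧ Module.finrank Λ _ = 1` for `D.S` and `X.X`,
  literally as in Theorem B; `char_Λ` = the tree's `Module.charIdeal`, `𝒳_tors = Submodule.torsion`.

## Flags for the registry / D-audit (nothing hidden)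

* `KY521-hK` (EXTRA `p ∤ h_K`, scope WEAKER), `KY521-Sel` (strict vs classical Selmer limits at
  `p ‖ N`: pseudo-isomorphic, transcription), `KY521-deriv` (`∃ z'`, WEAKER-or-equal), `KY521-sign` (the regularizing
  sign `α = a_p` is entered by reduction type: split ↦ `1`, non-split ↦ `-1`, Castella §2.2 verbatim;
  the Kummer-map sign convention is the tree's — the statement depends on `z` only through `Λz`).
* PROVENANCE: PRE ∘ PRE — KY Thm. 5.2.1's two-paragraph proof invokes [Cas24] Thm. 2.2 / Cor. 2.3 /
  Prop. 3.2 (unrefereed) and KY Thm. 5.1.3 (= Theorem D, whose printed proof has the located gap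
  `KYD-gap`, L1754, kernel counterexample `Summit.BirchSwinnertonDyer.Rank1Residual.X2.KellerYinFreePartGap`).
* NOT typed here (other seat's paper, same vocabulary now available): [Cas24] Thm. 1.3 (the `E[p]`
  IRREDUCIBLE sibling at `p > 3`, hypotheses (i)–(iv) incl. a generalized Heegner hypothesis with a
  ramified prime `q ∥ N`) — handed to seat `bsd-littype-11` / the lead on the cell bus.

## Contents (all in `namespace Literature.NumberTheory.EllipticCurves.KellerYin2024`)

* `Thm521Hypotheses` (structure, `Prop`), `thm521_multHg_charIdeal_torsion_eq_sq_OPEN` — Theorem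
  5.2.1 (ONE new named `Prop`, claim-tagged).
* PROVED: `Thm521Hypotheses.p_ne_two`, `Thm521Hypotheses.split_of_dvd` ((spl) is automatic at
  `p ∣ N`), `rankOne_of_thm521_OPEN` (the two rank clauses), `charIdeal_torsion_eq_sq_of_thm521_OPEN_of_not_split`
  / `charIdeal_torsion_dvd_sq_of_thm521_OPEN_of_not_split` (non-split case: equality and the
  Howard-Theorem-B-shaped divisibility for `Λ𝐳_∞`), `exists_derived_of_thm521_OPEN_of_split` (split
  case).

## References
* [KellerYin2024] arXiv:2402.12781v2: Thm. 5.2.1 `multHg` (L1783–L1792, PDF pp. 44–45), §5.2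
  (L1778–L1781), §5 standing (L1717–L1718), §0.1 (L228–L230), Thm. 5.1.3 (L1771), Cor. 5.2.2 (L1794).
* [Castella2024] arXiv:2409.01360: §1 (`𝔖_p`, `X`, `𝐳_∞^*`, Thm. 1.3), §2.2 eq. (2.2)–(2.3), Thm. 2.2,
  Cor. 2.3, Prop. 3.2. [BertoliniDarmon1996] Invent. Math. 126, §2.5 eq. (7)–(8), Prop. 2.7.
* [CastellaGrossiSkinner2025] Math. Ann. 393 (2025) Theorem C and [Howard2004HeegnerKolyvagin] Thm. B
  (the sibling layouts, shape only).
* Cell documents: `run/shared/lean/pub/bsd-littype/staging/bsd-littype-05/{LOCATOR,FAITHFULNESS}-05.md`,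
  `run/shared/lean/pub/bsd-littype/OPEN-QUESTIONS-05.md`.
-/

set_option autoImplicit false

noncomputable section

open scoped Classical

open WeierstrassCurve NumberField IsDedekindDomain Literature.NumberTheory.EllipticCurves
  Literature.NumberTheory.EllipticCurves.Rank1Residual
  Literature.NumberTheory.EllipticCurves.Castella2024

universe u

namespace Literature.NumberTheory.EllipticCurves.KellerYin2024

variable (N : ℕ) [NeZero N] (W : WeierstrassCurve ℚ) (K : Type u) [Field K] [NumberField K]
  (p : ℕ) [Fact p.Prime] (κ : ZpExtension K p) (γ : Field.absoluteGaloisGroup K)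
  (jbar : AlgebraicClosure K →+* ℂ)

/-- **Hypotheses of Keller–Yin, Theorem 5.2.1 (`multHg`) for an elliptic curve** in the tree's
vocabulary (the bundle `ThmBHypotheses` of Theorem B with "good" replaced by "multiplicative" and the
now automatic (spl) dropped): `E/ℚ` elliptic with conductor `N` (the level of the Heegner family);
"`p ≠ 2`", "`p ∣∣ N` … bad multiplicative reduction at `p`" (`2 < p`, `Mult W p`); "Eisenstein"
(`Red W p`); `K` imaginary quadratic with (Heeg) "all primes dividing `N` split completely in `K`"
(so `p` splits, `split_of_dvd`), (disc) "`D_K` is odd and `≠ -3`" (§0.1); `κ` the anticyclotomic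
`ℤ_p`-extension with topological generator `γ`; and the EXTRA standing hypothesis `p ∤ h_K` of the
tree's Heegner-family vocabulary (flag `KY521-hK`; not printed by KY — special case).
[claim: KellerYin2024, status: under-review]
[cite: CastellaGrossiSkinner2025, Theorem C (§0.1) hypotheses (Heeg), (disc) (the bundle shape reused; shape only)] -/
structure Thm521Hypotheses : Prop where
  /-- `E` is an elliptic curve. -/
  isElliptic : W.IsElliptic
  /-- `N` is the conductor of `E`. -/
  level : N = W.conductorNorm ℤ
  /-- `p ≠ 2` (§5 standing, L1718; §0.1 "`p > 2`", L228). -/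
  two_lt : 2 < p
  /-- `p ∣∣ N`: `p` is a prime of (bad) multiplicative reduction. -/
  mult : Mult W p
  /-- `p` is Eisenstein: `E[p]` is reducible. -/
  red : Red W p
  /-- `K` is imaginary quadratic. -/
  isImaginaryQuadratic : IsImaginaryQuadratic K
  /-- (Heeg): every prime dividing `N` splits in `K` (in particular `p`). -/
  heegner : SatisfiesHeegnerHypothesis N K
  /-- (disc), first half: `D_K` is odd. -/
  discr_odd : Odd (discr K)
  /-- (disc), second half: `D_K ≠ -3`. -/
  discr_ne : discr K ≠ -3
  /-- EXTRA (special case, tree Heegner families: `K_n ⊆ K[p^{n+1}]`): `p ∤ h_K`. -/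
  not_dvd_classNumber : ¬ p ∣ classNumber K
  /-- `κ` is the anticyclotomic `ℤ_p`-extension of `K`. -/
  anticyclotomic : κ.IsAnticyclotomic
  /-- `γ` is a topological generator of `Gal(K_∞/K)`. -/
  topGenerator : κ.IsTopGenerator γ

-- TODO(general form): KY Thm. 5.2.1 is printed for newforms `f ∈ S_2(Γ_0(N))` with arbitrary
-- coefficient rings (`Λ = 𝒪⟦T⟧`, `𝐓 = T ⊗ Λ` for a chosen lattice `T`) and without `p ∤ h_K`; the
-- field `not_dvd_classNumber` is the tree vocabulary's (Howard 2004 §3.3) standing hypothesis.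

/-- **OPEN HYPOTHESIS — UNREFEREED PREPRINT (Keller–Yin, arXiv:2402.12781v2, Theorem 5.2.1
`multHg`).** Verbatim (v2 TeX L1783–L1787): "Let `f ∈ S_2(Γ_0(N))` be a newform of weight `2` and
assume that `p ∣∣ N` is an Eisenstein prime for `f`. Then both `H¹_{𝓕_Λ}(K, 𝐓)` and
`𝒳 = H¹_{𝓕_Λ}(K, M_f)^∨` have `Λ`-rank one, and the equality
`Char_Λ(𝒳_tors) = Char_Λ(H¹_{𝓕_Λ}(K, 𝐓)/Λ𝐳_∞^*)²` holds." with (L1781) "`𝐳_∞^*` … either a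
standard `Λ`-adic Heegner class `𝐳_∞` … in the non-split multiplicative case, or a derived Heegner
class `𝐳_∞'` defined by the relation `𝐳_∞ = (γ-1)𝐳_∞'` in the split multiplicative case".
TRANSCRIBED for `f ↔ E` an elliptic curve over `ℚ`, in the layout of Theorem B / the PUBLISHED CGS
Theorem C (module docstring for the dictionary and the flags `KY521-hK` / `-Sel` / `-deriv` /
`-sign`): under `Thm521Hypotheses` (special case `p ∤ h_K`), for every `Λ`-adic Selmer datum `D`
(`𝔖_p = H¹_{𝓕_Λ}(K, 𝐓)`, `D.S`), Heegner family `F` at level `N = N_E` and Selmer-dual datum `X`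
(`𝒳`, `X.X`) of `E/K` along `κ`: `𝔖_p` and `𝒳` are finitely generated of `Λ`-rank one; at a
NON-SPLIT multiplicative `p`, for every `z ∈ D.S` which is the `Λ`-adic Heegner class of `F` with
sign `α = a_p = -1` (`Castella2024.IsLambdaAdicHeegnerClass D F (-1) z`),
`char_Λ(𝒳_tors) = char_Λ(𝔖_p/Λz)²`; at a SPLIT multiplicative `p`, for every such `z` with
`α = a_p = 1` there is a derived class `z'` with `z = T • z'` (`T = γ - 1`) and
`char_Λ(𝒳_tors) = char_Λ(𝔖_p/Λz')²`, in `Λ = ℤ_p⟦T⟧`. Printed proof: [Cas24] explicit reciprocity law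
Thm. 2.2 / Cor. 2.3 and Prop. 3.2 ⇒ equivalence with Thm. 5.1.3 (= Theorem D,
`thmD_imcMult_exists_isBDPLFunction_isTorsion_charIdeal_eq_OPEN`); PRE ∘ PRE. NEVER cite this `Prop`
as a theorem: take it as an explicit hypothesis; a result using it is conditional on unrefereed claims.
[claim: KellerYin2024, status: under-review]
[cite: BertoliniDarmon1996, §2.5 eq. (7)–(8), Prop. 2.7 (the regularized classes z_m, α = a_p = ±1; the transcription of Λ𝐳_∞)]
[cite: CastellaGrossiSkinner2025, Theorem C (§0.1) = Cor. 5.5.4 (the layout reused; shape only)] -/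
def thm521_multHg_charIdeal_torsion_eq_sq_OPEN : Prop :=
  ∀ (_ : Thm521Hypotheses N W K p κ γ) (D : (W.baseChange K).LambdaAdicSelmerData κ γ)
    (F : HeegnerFamily N W K κ jbar) (X : (W.baseChange K).SelmerDualData κ γ),
    -- "both `H¹_{𝓕_Λ}(K, 𝐓)` and `𝒳` have `Λ`-rank one"
    (Module.Finite (IwasawaAlgebra p) D.S ∧ Module.finrank (IwasawaAlgebra p) D.S = 1) ∧
    (Module.Finite (IwasawaAlgebra p) X.X ∧ Module.finrank (IwasawaAlgebra p) X.X = 1) ∧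
    -- non-split multiplicative `p` (`α = a_p = -1`): `𝐳_∞^* = 𝐳_∞`
    (¬ W.HasSplitMultiplicativeReductionAtPrime p → ∀ z : D.S, IsLambdaAdicHeegnerClass D F (-1) z →
      Module.charIdeal (IwasawaAlgebra p) (Submodule.torsion (IwasawaAlgebra p) X.X) =
        Module.charIdeal (IwasawaAlgebra p) (D.S ⧸ Submodule.span (IwasawaAlgebra p) {z}) ^ 2) ∧
    -- split multiplicative `p` (`α = a_p = 1`): `𝐳_∞^* = 𝐳_∞'`, `𝐳_∞ = (γ - 1) 𝐳_∞'`
    (W.HasSplitMultiplicativeReductionAtPrime p → ∀ z : D.S, IsLambdaAdicHeegnerClass D F 1 z →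
      ∃ z' : D.S, z = (PowerSeries.X : IwasawaAlgebra p) • z' ∧
        Module.charIdeal (IwasawaAlgebra p) (Submodule.torsion (IwasawaAlgebra p) X.X) =
          Module.charIdeal (IwasawaAlgebra p) (D.S ⧸ Submodule.span (IwasawaAlgebra p) {z'}) ^ 2)

/-- **Keller–Yin, Thm. 5.2.1 (`multHg`) — PINNED to a minimal-degree parametrisation with `p`-ADIC-UNIT MANIN CONSTANT** (BSD cited-literature audit ARM P, REGISTER R-15 / TY-QUEUE 25; reader bsd-cited-r19 sheets
`D-AUDIT-r19-ADDENDUM-5.md` sha16 6a0e68f1a5f0faa2 §4, ADDENDUM-6 c1c6b9e51d6d0dd9 and ADDENDUM-8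
24e75636994fcc95 (v2) §4 (the Manin pin, rider R-b of r17 ADDENDUM-4 0434952c634f1c51); typer bsd-cited-ty4 g7/g8/g10,
2026-08-27; lead rulings (181)/(198)/(243) + RULING (316) «TYQ 25: kit v5.2 is the release shape»): the statement of
`thm521_multHg_charIdeal_torsion_eq_sq_OPEN` (kept byte-identical above) with TWO extra hypotheses as binders right after `F` and the instance
binder `[W.IsGloballyMinimal]` (`F.Dt.c` is the Manin constant w.r.t. a NÉRON differential only on a globally minimal model —
`ModularCurve.lean` `isNeronLattice`/`c`; r19 ADD-8 §1.1):
(F1) `∀ Dt', F.Dt.deg ≤ Dt'.deg` — minimal modular degree among the data of the same curve and level (`φ = ±φ_min`) =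
VERBATIM the body of `ModularForms.ModularParametrizationData.IsMinimal F.Dt` (`ModularParametrizationScalingProofs.lean`,
p482958: `exists_isMinimal`, `IsMinimal.deg_eq`, `not_isMinimal_zsmul`), spelled out because that module lies DOWNSTREAM of
this file (an `import` would close a cycle); the two agree by `Iff.rfl` — kernel lemma `TYQ25Check.pin_iff_isMinimal_heegnerFamily`
of the kit file `run/shared/lean/pub/bsd-cited/staging/bsd-cited-ty4/TYQ25-kit/check/K_TYQ25_pin_iff_isMinimal.lean` sha16
3e421a28abe396fd (imports both modules; farm rc 0, axioms trio; lead (243)).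
(F1′, the MANIN PIN) `¬ (p : ℤ) ∣ F.Dt.c` — the Manin constant of `φ` (`φ^*ω_W = c · 2πi f dτ`) is a `p`-adic unit:
Perrin-Riou's Conj. B carries the factor `c_π · (#𝒪_K^× / 2)` [PR87 §1 p. 405; BCK21 Rem. after Conj. 1], which the `c`-free
form printed here drops exactly when it is a `p`-adic unit (Mazur 1978 Cor. 4.1 for the OPTIMAL curve; NOT automatic for a
non-optimal curve at an Eisenstein `p` — PR87 p. 409 Ex. 3, `X_0(11)/μ_5` at `p = 5`); inside the pin the statement does
not depend on the parametrisation (r19 ADD-8 kernel `sheets/r19-add8/d_audit_r19_add8_manin_pin_check.lean` f8a7d8f730b7607f,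
K2 `nonsplitClause_iff_zsmul` / `charIdeal_quot_span_C_smul_eq_of_not_dvd`, K3 shapes `…ManinPinned`; TREE theorems
`heegnerCharIdeal_zsmul_of_not_dvd` / `heegnerModule_zsmul_of_not_dvd` / `charIdeal_quotient_span_C_smul_eq_of_not_dvd` of
`HeegnerModuleScalingProofs.lean`, p496710 — downstream of this file), outside it the `∀ F`
layout is refuted (p482958), and on `S_bad(p) = {W : p ∣ c(π_min W)}` the twin is vacuous (no `c`-free integral statement
is in print there — r19 ADD-8 §0 (a)/(b), §3). WHY: print works with ONE fixed parametrisation (the optimal quotient `A_f` and its Heegner classes `κ_∞` of §3; [Cas24] «Upon the choice of a modular parametrization `X_0(N) → E` … which we fix from now on», TeX l.268), whereas `∀ (F : HeegnerFamily …)` ranges over every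
rescaling `[m] ∘ φ` of it (`F.Dt.c ↦ m · F.Dt.c`; points and `Λ`-adic class scale by `m` — kernel theorems
`HeegnerFamily.zsmul` / `KellerYin2024.false_of_thm521_OPEN_zsmul` (p481261), `HeegnerFamily.zsmulSelf` /
`false_of_thm521_OPEN_of_witness` (p482958)), and an INTEGRAL equality of characteristic ideals cannot hold for a class
and its `p`-multiple at once (`char_Λ(𝔖/Λpz) = (p) · char_Λ(𝔖/Λz)`): the unpinned binder above is STRONGER than print, this
pinned one is print's statement (reader's verdict word VERBATIM-SPECIALISED; flag `HPMC-Manin-normalisation`, priced by the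
desks). The bridge `thm521_multHg_charIdeal_torsion_eq_sq_minimal_OPEN_of_unpinned` (unpinned ⇒ pinned) is PROVED, so nothing is asserted beyond the declaration above;
divisibility-shaped binders are unaffected (r19 ADD-5 §4.3).
NEVER cite this `Prop` as a theorem: take it as an explicit hypothesis; a result using it is conditional on
unrefereed claims.
[claim: KellerYin2024, status: under-review]
[cite: BertoliniDarmon1996, §2.5 eq. (7)–(8), Prop. 2.7 (the regularized classes z_m, α = a_p = ±1; the transcription of Λ𝐳_∞)]
[cite: CastellaGrossiSkinner2025, Theorem C (§0.1) = Cor. 5.5.4 (the layout reused; shape only)]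
[cite: PerrinRiou1987BSMF, §1 Conj. B p. 405 (the factor c_π · u)] [cite: BurungaleCastellaKim2021, Remark after Conj. 1 (the factor c_π · #𝒪_K^× / 2; Mazur for p ∤ N)] -/
def thm521_multHg_charIdeal_torsion_eq_sq_minimal_OPEN [W.IsGloballyMinimal] : Prop :=
  ∀ (_ : Thm521Hypotheses N W K p κ γ) (D : (W.baseChange K).LambdaAdicSelmerData κ γ)
    (F : HeegnerFamily N W K κ jbar)
    -- PINNED (fix F1): `F.Dt` has minimal modular degree (`φ = ±φ_min`) — verbatim the body of
    -- `ModularForms.ModularParametrizationData.IsMinimal F.Dt` (`ModularParametrizationScalingProofs.lean`)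
    (_ : ∀ Dt' : ModularForms.ModularParametrizationData W N, F.Dt.deg ≤ Dt'.deg)
    -- PINNED (fix F1′, the Manin pin — rider R-b): the parametrisation's Manin constant is a `p`-adic unit
    (_ : ¬ (p : ℤ) ∣ F.Dt.c)
    (X : (W.baseChange K).SelmerDualData κ γ),
    -- "both `H¹_{𝓕_Λ}(K, 𝐓)` and `𝒳` have `Λ`-rank one"
    (Module.Finite (IwasawaAlgebra p) D.S ∧ Module.finrank (IwasawaAlgebra p) D.S = 1) ∧
    (Module.Finite (IwasawaAlgebra p) X.X ∧ Module.finrank (IwasawaAlgebra p) X.X = 1) ∧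
    -- non-split multiplicative `p` (`α = a_p = -1`): `𝐳_∞^* = 𝐳_∞`
    (¬ W.HasSplitMultiplicativeReductionAtPrime p → ∀ z : D.S, IsLambdaAdicHeegnerClass D F (-1) z →
      Module.charIdeal (IwasawaAlgebra p) (Submodule.torsion (IwasawaAlgebra p) X.X) =
        Module.charIdeal (IwasawaAlgebra p) (D.S ⧸ Submodule.span (IwasawaAlgebra p) {z}) ^ 2) ∧
    -- split multiplicative `p` (`α = a_p = 1`): `𝐳_∞^* = 𝐳_∞'`, `𝐳_∞ = (γ - 1) 𝐳_∞'`
    (W.HasSplitMultiplicativeReductionAtPrime p → ∀ z : D.S, IsLambdaAdicHeegnerClass D F 1 z →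
      ∃ z' : D.S, z = (PowerSeries.X : IwasawaAlgebra p) • z' ∧
        Module.charIdeal (IwasawaAlgebra p) (Submodule.torsion (IwasawaAlgebra p) X.X) =
          Module.charIdeal (IwasawaAlgebra p) (D.S ⧸ Submodule.span (IwasawaAlgebra p) {z'}) ^ 2)

variable {N W K p κ γ jbar}

/-- **Bridge, PROVED**: the unpinned `thm521_multHg_charIdeal_torsion_eq_sq_OPEN` implies its pinned twin (the two extra
hypotheses are discarded) — so the twin is a WEAKENING, never a strengthening. [claim: KellerYin2024, status: under-review] -/
theorem thm521_multHg_charIdeal_torsion_eq_sq_minimal_OPEN_of_unpinned [W.IsGloballyMinimal]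
    (h : thm521_multHg_charIdeal_torsion_eq_sq_OPEN N W K p κ γ jbar) :
    thm521_multHg_charIdeal_torsion_eq_sq_minimal_OPEN N W K p κ γ jbar :=
  fun hyp D F _ _ X ↦ h hyp D F X

omit [NeZero N] in
/-- The hypotheses make `p` odd. [claim: KellerYin2024, status: under-review] -/
theorem Thm521Hypotheses.p_ne_two (hyp : Thm521Hypotheses N W K p κ γ) : p ≠ 2 := by
  have := hyp.two_lt
  omega

omit [NeZero N] in
/-- **(spl) is automatic**: under (Heeg) every prime dividing the level splits in `K`, so `p = v v̄`
splits as soon as `p ∣ N` (which `p ∣∣ N` says; §0.1 lists (spl) separately because Theorems A–C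
concern `p ∤ N`). [cite: GrossLMS1991, §1 (p. 235) (Heegner hypothesis: every prime dividing N splits)] -/
theorem Thm521Hypotheses.split_of_dvd (hyp : Thm521Hypotheses N W K p κ γ) (hpN : p ∣ N) :
    ((Ideal.span {(p : ℤ)}).primesOver (𝓞 K)).ncard = 2 :=
  hyp.heegner p Fact.out hpN

/-- **Thm. 5.2.1 ⇒ the two rank clauses**: `𝔖_p = H¹_{𝓕_Λ}(K, 𝐓)` and `𝒳` are finitely generated
of `Λ`-rank one (the rank-one halves of the Heegner point main conjecture at `p ‖ N`; Howard-Theorem-B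
(a)/(b) shape). CONDITIONAL on the OPEN fact. [claim: KellerYin2024, status: under-review] -/
theorem rankOne_of_thm521_OPEN (h : thm521_multHg_charIdeal_torsion_eq_sq_OPEN N W K p κ γ jbar)
    (hyp : Thm521Hypotheses N W K p κ γ) (D : (W.baseChange K).LambdaAdicSelmerData κ γ)
    (F : HeegnerFamily N W K κ jbar) (X : (W.baseChange K).SelmerDualData κ γ) :
    (Module.Finite (IwasawaAlgebra p) D.S ∧ Module.finrank (IwasawaAlgebra p) D.S = 1) ∧
      (Module.Finite (IwasawaAlgebra p) X.X ∧ Module.finrank (IwasawaAlgebra p) X.X = 1) :=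
  ⟨(h hyp D F X).1, (h hyp D F X).2.1⟩

/-- **Thm. 5.2.1 at a NON-SPLIT multiplicative `p`**: `char_Λ(𝒳_tors) = char_Λ(𝔖_p/Λ𝐳_∞)²` for
the `Λ`-adic Heegner class `𝐳_∞` of sign `α = a_p = -1`. CONDITIONAL on the OPEN fact.
[claim: KellerYin2024, status: under-review] -/
theorem charIdeal_torsion_eq_sq_of_thm521_OPEN_of_not_split
    (h : thm521_multHg_charIdeal_torsion_eq_sq_OPEN N W K p κ γ jbar)
    (hyp : Thm521Hypotheses N W K p κ γ) (hns : ¬ W.HasSplitMultiplicativeReductionAtPrime p)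
    (D : (W.baseChange K).LambdaAdicSelmerData κ γ) (F : HeegnerFamily N W K κ jbar)
    (X : (W.baseChange K).SelmerDualData κ γ) {z : D.S} (hz : IsLambdaAdicHeegnerClass D F (-1) z) :
    Module.charIdeal (IwasawaAlgebra p) (Submodule.torsion (IwasawaAlgebra p) X.X) =
      Module.charIdeal (IwasawaAlgebra p) (D.S ⧸ Submodule.span (IwasawaAlgebra p) {z}) ^ 2 :=
  (h hyp D F X).2.2.1 hns z hz

/-- **Non-split case, divisibility form** (Howard 2004 Thm. B (c) shape, the half a Kolyvagin-system
argument gives): `char_Λ(𝒳_tors) ∣ char_Λ(𝔖_p/Λ𝐳_∞)²`. CONDITIONAL on the OPEN fact.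
[claim: KellerYin2024, status: under-review] -/
theorem charIdeal_torsion_dvd_sq_of_thm521_OPEN_of_not_split
    (h : thm521_multHg_charIdeal_torsion_eq_sq_OPEN N W K p κ γ jbar)
    (hyp : Thm521Hypotheses N W K p κ γ) (hns : ¬ W.HasSplitMultiplicativeReductionAtPrime p)
    (D : (W.baseChange K).LambdaAdicSelmerData κ γ) (F : HeegnerFamily N W K κ jbar)
    (X : (W.baseChange K).SelmerDualData κ γ) {z : D.S} (hz : IsLambdaAdicHeegnerClass D F (-1) z) :
    Module.charIdeal (IwasawaAlgebra p) (Submodule.torsion (IwasawaAlgebra p) X.X) ∣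
      Module.charIdeal (IwasawaAlgebra p) (D.S ⧸ Submodule.span (IwasawaAlgebra p) {z}) ^ 2 :=
  dvd_of_eq (charIdeal_torsion_eq_sq_of_thm521_OPEN_of_not_split h hyp hns D F X hz)

/-- **Thm. 5.2.1 at a SPLIT multiplicative `p` (exceptional-zero case)**: the `Λ`-adic Heegner class
`𝐳_∞` of sign `α = a_p = 1` is divisible by `γ - 1` in `𝔖_p` — there is a derived class `𝐳_∞'` with
`𝐳_∞ = (γ-1) • 𝐳_∞'` — and `char_Λ(𝒳_tors) = char_Λ(𝔖_p/Λ𝐳_∞')²` for such a `𝐳_∞'`. CONDITIONAL on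
the OPEN fact. [claim: KellerYin2024, status: under-review] -/
theorem exists_derived_of_thm521_OPEN_of_split
    (h : thm521_multHg_charIdeal_torsion_eq_sq_OPEN N W K p κ γ jbar)
    (hyp : Thm521Hypotheses N W K p κ γ) (hs : W.HasSplitMultiplicativeReductionAtPrime p)
    (D : (W.baseChange K).LambdaAdicSelmerData κ γ) (F : HeegnerFamily N W K κ jbar)
    (X : (W.baseChange K).SelmerDualData κ γ) {z : D.S} (hz : IsLambdaAdicHeegnerClass D F 1 z) :
    ∃ z' : D.S, z = (PowerSeries.X : IwasawaAlgebra p) • z' ∧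
      Module.charIdeal (IwasawaAlgebra p) (Submodule.torsion (IwasawaAlgebra p) X.X) =
        Module.charIdeal (IwasawaAlgebra p) (D.S ⧸ Submodule.span (IwasawaAlgebra p) {z'}) ^ 2 :=
  (h hyp D F X).2.2.2 hs z hz

/-- **Split case, `T`-divisibility alone**: at a split multiplicative Eisenstein `p ‖ N` the
`Λ`-adic Heegner class lies in `(γ - 1) 𝔖_p` (the "trivial zero of the `p`-adic `L`-function",
KY L1781; Castella 2024 Thm. 2.1: `pr_0(𝐳_∞) = 0`), as a consequence of the typed statement.
CONDITIONAL on the OPEN fact. [claim: KellerYin2024, status: under-review] -/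
theorem mem_span_X_smul_top_of_thm521_OPEN_of_split
    (h : thm521_multHg_charIdeal_torsion_eq_sq_OPEN N W K p κ γ jbar)
    (hyp : Thm521Hypotheses N W K p κ γ) (hs : W.HasSplitMultiplicativeReductionAtPrime p)
    (D : (W.baseChange K).LambdaAdicSelmerData κ γ) (F : HeegnerFamily N W K κ jbar)
    (X : (W.baseChange K).SelmerDualData κ γ) {z : D.S} (hz : IsLambdaAdicHeegnerClass D F 1 z) :
    z ∈ Ideal.span {(PowerSeries.X : IwasawaAlgebra p)} • (⊤ : Submodule (IwasawaAlgebra p) D.S) := by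
  obtain ⟨z', hz', -⟩ := exists_derived_of_thm521_OPEN_of_split h hyp hs D F X hz
  rw [hz']
  exact Submodule.smul_mem_smul (Ideal.mem_span_singleton_self _) Submodule.mem_top

end Literature.NumberTheory.EllipticCurves.KellerYin2024

end
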